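import Summits.BirchSwinnertonDyer.BirchSwinnertonDyer.Theorems.KolyvaginDepthDoorMSymbolCert571b1
import HarnessLib

/-!
# Route `KolyvaginDepthDoor`, crux `KolyvaginDepthSupplyKN` (stmt-BirchSwinnertonDyer-22820) —
# DEPTH TABLE v27: the E-side Kurihara claim of row `571b1` @ `(5, 11·41)` is a KERNEL THEOREM

Helper file of the lead prover of line `levelone` (kdd-p1 g31; `--supports stmt-BirchSwinnertonDyer-22820 --as helper`); it
closes nothing and BSD is NOT proved by it. `C571b1.kuriharaClaim_5_451` is the hypothesis `hδE` of the v17 row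
`C571b1.cruxBody_of_kuriharaClaims_5_neg7` VERBATIM (the claim of the tree record `cert_571b1` @ `(5, 451)`, so far PARI output taken on
trust), proved by the kernel-certified plus M-symbol of `571b1` (`…MSymbolCert571b1`); the Manin-constant / period hypotheses of the
claim are not used. Per curve; (S♭) untouched; BSD is NOT proved by any of this.

References: [Kim2022StructureSelmer] §1.4.3; [CremonaAlgorithms1997] §2.2–2.5, Table 1 (571b1).
-/

set_option linter.dupNamespace false

noncomputable section

open scoped Classical NumberField

namespace Summit.BirchSwinnertonDyer.BirchSwinnertonDyer.Theorems.KolyvaginDepthDoor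

open Literature.NumberTheory.EllipticCurves Literature.NumberTheory.EllipticCurves.ModularForms
  WeierstrassCurve NumberField IsDedekindDomain
open Summit.BirchSwinnertonDyer.BirchSwinnertonDyer.Theorems
open Summit.BirchSwinnertonDyer.BirchSwinnertonDyer.Rank2Observatory

namespace C571b1

/-- **THE E-SIDE KURIHARA CLAIM OF ROW `571b1` @ `(5, 11·41)` IS A THEOREM** — literally the hypothesis `hδE` of
`cruxBody_of_kuriharaClaims_5_neg7`. [cite: Kim2022StructureSelmer, §1.4.3] [cite: CremonaAlgorithms1997, §2.2–2.5] -/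
theorem kuriharaClaim_5_451 :
    haveI := isElliptic_c571b1; haveI := isGloballyMinimal_c571b1;
      haveI : NeZero (((⟨0, 1, 1, -4, 2⟩ : WeierstrassCurve ℤ).map (Int.castRingHom ℚ)).conductorNorm ℤ) :=
        neZero_conductorNorm_of_isElliptic _;
      haveI := Fact.mk (by norm_num : Nat.Prime 5);
      ∀ (D : ModularParametrizationData ((⟨0, 1, 1, -4, 2⟩ : WeierstrassCurve ℤ).map (Int.castRingHom ℚ))
          (((⟨0, 1, 1, -4, 2⟩ : WeierstrassCurve ℤ).map (Int.castRingHom ℚ)).conductorNorm ℤ)),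
        ¬ ((5 : ℕ) : ℤ) ∣ D.maninConstant →
        (∃ u : ℚ, ‖(u : ℚ_[5])‖ = 1 ∧
          ((⟨0, 1, 1, -4, 2⟩ : WeierstrassCurve ℤ).map (Int.castRingHom ℚ)).realPeriodRat = u * plusPeriod D.f) →
        ∃ ψ : (ℓ : ℕ) → (ZMod ℓ)ˣ →* Multiplicative (ZMod 5),
          (∀ ℓ ∈ (451 : ℕ).primeFactors, Function.Surjective (ψ ℓ)) ∧ kuriharaNumber D.f 5 451 ψ ≠ 0 := by
  intro D _ _
  haveI := isElliptic_c571b1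
  haveI : NeZero (((⟨0, 1, 1, -4, 2⟩ : WeierstrassCurve ℤ).map (Int.castRingHom ℚ)).conductorNorm ℤ) := neZero_conductorNorm_of_isElliptic _
  exact MSymbolCert.Cert571b1.exists_kuriharaNumber_ne_zero_571b1 _ C571b1.conductorNorm_eq D

end C571b1

end Summit.BirchSwinnertonDyer.BirchSwinnertonDyer.Theorems.KolyvaginDepthDoor

end
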